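import Literature.Probability.Percolation.SlabCircuitFromCornerLinks
import Literature.Probability.Percolation.SlabCircuitUniqueness
import Literature.Probability.Percolation.SlabRSWGluingGeometry
import Literature.Probability.Percolation.HarrisLocal
import Literature.Probability.Percolation.RSW
import HarnessLib

/-!
# Newman–Tassion–Wu 2017, Theorem 3.10 — the events of the probabilistic skeleton: side crossings,
# hub crossings, corner domains, and the corner-gluing inequality left to the surgery layer

Topic: `Literature/Probability/Percolation`. Sixth file of the port of THEOREM 3.10 of
Newman–Tassion–Wu, *Critical percolation and the minimal spanning tree in slabs* (CPAM 70 (2017);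
arXiv:1512.09107, pp. 12–14).  NTW: "we wish to show that the event `ℰ` occurs with probability
larger than some positive constant … `P[ℰ] ≥ P[ℰ₀] - 2 P[ℰ₀ ∖ 𝒰₁]` … Harris–FKG … BK … We claim that
there exists a constant `c₃ > 0` such that `P[𝒜_{λn,λn+n}] ≥ c₃² P[ℰ]`, which will then finish the
proof.  To show this, we now perform a two step gluing procedure in the square regions `R₁` and
`R₂`".  In the port's geometry (`SlabCircuitFromCornerLinks.lean`: hole `[-N,N]²`, `W = N+n+1`, four
rectangular sides `ringSideT, …`, truncated domains `domT, …`, corridors `corR, …`, corner links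
`cornerLink₁..₄`, hub strips `hubT, …` with uniqueness events `hubUniqT, …`) this file proves:

* `sideCrossT/R/B/L` — the four long-way side crossings (`ℰ₀ = ⋂ sideCross`); `hubCross*` — the hub
  strip crossings; `slabConn_suffix` — the part of a crossing after its last visit to a level stays on
  one side of it (how `sideCrossR` supplies both the corridor path of the top-right corner and the
  minimal-path domain `domR` of the bottom-right corner).
* `NTW17.CornerGlue₁..₄ k N n p K` — THE REMAINING INPUT, in final form: the gluing inequality of the
  corner in the presence of a bystander event determined by edges off the corner square,
  `P[G ∩ {dom crossed} ∩ {corridor crossed} ∖ cornerLink] ≤ K · P[G ∩ cornerLink]` (NTW's map `Φ` of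
  (3.121)–(3.122) with Lemma 3.5; to be supplied by the located-gadget surgery of the tree's
  `SlabRSWGluing*` in this geometry).
* `domT_cross_of_sideCrossT`, `corR_cross_of_sideCrossR`, … — what each side crossing supplies to
  the two corners it takes part in.

(The probability bookkeeping — (3.66)–(3.74) and the chain of the four gluings — follows in
`SlabCircuitUniqBound.lean` and `SlabCircuitAssembly.lean`.)

## Sources

* C. M. Newman, V. Tassion, W. Wu, *Critical percolation and the minimal spanning tree in slabs*,
  Comm. Pure Appl. Math. 70 (2017) 2084–2120, arXiv:1512.09107: proof of Theorem 3.10, displays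
  (3.65)–(3.74) and (3.121)–(3.122) (pp. 12–14) [NewmanTassionWu2017].
-/

noncomputable section

namespace Literature.Probability.Percolation

open MeasureTheory LatticeModels
open scoped LatticeModels

namespace NTW17

variable {k : ℕ}

/-! ## Crossings after the last visit to a level -/

/-- `X ⟷^B Y` is monotone in the domain `B`. [cite: NewmanTassionWu2017, §3.1 (crossing events)] -/
theorem slabConn_mono_dom {B B' X Y : Set (ℤ × ℤ)} (hB : B ⊆ B') {ω : BondConfig (slab 3 k)}
    (h : ω ∈ slabConn k B X Y) : ω ∈ slabConn k B' X Y := by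
  rw [mem_slabConn_iff_exists_isOSAP] at h ⊢
  obtain ⟨l, hl⟩ := h
  exact ⟨l, hl.nodup, hl.chain, fun x hx => slabLift_mono k hB (hl.subset x hx), hl.ne_nil, hl.head_mem, hl.last_mem⟩

/-- **The part of a crossing after its last visit to a level.**  Let `φ` be a coordinate functional
(1-Lipschitz along lattice steps in both directions) and `ω` a lattice configuration.  If
`ω ∈ X ⟷^B Y` where `φ ≤ m` on `X` and `φ > m` on `Y`, then the part of the crossing after its last
vertex with `φ ≤ m` starts ON the level `φ = m` and stays strictly above it:
`ω ∈ {φ = m} ⟷^{B ∩ {φ ≥ m}} Y`. [cite: NewmanTassionWu2017, Theorem 3.10 (proof, paths restricted to sub-regions)] -/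
theorem slabConn_suffix {ω : BondConfig (slab 3 k)} (hω : ω ⊆ (slabGraph 3 k).edgeSet)
    {φ : ℤ × ℤ → ℤ} (hφ : ∀ z w, planarAdj z w → φ w ≤ φ z + 1 ∧ φ z ≤ φ w + 1) {B X Y : Set (ℤ × ℤ)}
    {m : ℤ} (hX : ∀ z ∈ X, φ z ≤ m) (hY : ∀ z ∈ Y, m < φ z) (h : ω ∈ slabConn k B X Y) :
    ω ∈ slabConn k (B ∩ {z | m ≤ φ z}) {z | φ z = m} Y := by
  rw [mem_slabConn_iff_exists_isOSAP] at h ⊢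
  obtain ⟨l, hl⟩ := h
  have hhead : φ (planar k (l.head hl.ne_nil)) ≤ m := hX _ (hl.head_mem hl.ne_nil)
  obtain ⟨l₁, p, l₂, hsplit, hp, hno⟩ :=
    exists_last_split (p := fun z => φ (planar k z) ≤ m) l ⟨l.head hl.ne_nil, List.head_mem hl.ne_nil, hhead⟩
  have hp' : φ (planar k p) ≤ m := hp
  have hlast : m < φ (planar k (l.getLast hl.ne_nil)) := hY _ (hl.last_mem hl.ne_nil)
  -- the chain from `p` on
  have hc2 : (p :: l₂).IsChain (fun a b => s(a, b) ∈ ω ∧ a ≠ b) := by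
    rw [hsplit] at hl; exact hl.chain.right_of_append
  -- `p` is on the level
  have hpm : φ (planar k p) = m := by
    cases l₂ with
    | nil =>
      have : l.getLast hl.ne_nil = p := by simp [hsplit]
      rw [this] at hlast; omega
    | cons v t =>
      rw [List.isChain_cons_cons] at hc2
      have hv : ¬φ (planar k v) ≤ m := hno v (by simp)
      have : φ (planar k v) ≤ φ (planar k p) + 1 := by
        rcases planar_rel_of_open hω hc2.1 with he | ha
        · rw [he]; omega
        · exact (hφ _ _ ha).1
      omega
  refine ⟨p :: l₂, (hsplit ▸ hl.nodup).sublist (List.sublist_append_right l₁ _), hc2, ?_, List.cons_ne_nil _ _,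
    fun _ => by simpa using hpm, fun _ => ?_⟩
  · intro x hx
    refine ⟨hl.subset x (by rw [hsplit]; exact List.mem_append_right _ hx), ?_⟩
    simp only [Set.mem_setOf_eq]
    rcases List.mem_cons.1 hx with rfl | hx
    · omega
    · have := hno x hx; simp only [not_le] at this; omega
  · have : (p :: l₂).getLast (List.cons_ne_nil _ _) = l.getLast hl.ne_nil := by
      simp [hsplit, List.getLast_append_of_ne_nil]
    rw [this]; exact hl.last_mem hl.ne_nil

/-! ## The side and hub crossings -/

section Events

variable (k) (N n : ℕ)

/-- `K_T`: the top side crossed from its left column `x = -(N+n)` to its right column `x = N+n+1`.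
[cite: NewmanTassionWu2017, Theorem 3.10 (proof, the event ℰ₀)] -/
def sideCrossT : Set (BondConfig (slab 3 k)) :=
  slabConn k (ringSideT N n) {z | z.1 = -((N : ℤ) + n)} {z | z.1 = (N : ℤ) + n + 1}

/-- `K_R = ϱ(K_T)`: the right side crossed from its top row `y = N+n` to its bottom row `y = -(N+n+1)`.
[cite: NewmanTassionWu2017, Theorem 3.10 (proof, the event ℰ₀)] -/
def sideCrossR : Set (BondConfig (slab 3 k)) :=
  slabConn k (ringSideR N n) {z | z.2 = (N : ℤ) + n} {z | z.2 = -((N : ℤ) + n + 1)}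

/-- `K_B = ϱ²(K_T)`. [cite: NewmanTassionWu2017, Theorem 3.10 (proof, the event ℰ₀)] -/
def sideCrossB : Set (BondConfig (slab 3 k)) :=
  slabConn k (ringSideB N n) {z | z.1 = (N : ℤ) + n} {z | z.1 = -((N : ℤ) + n + 1)}

/-- `K_L = ϱ³(K_T)`. [cite: NewmanTassionWu2017, Theorem 3.10 (proof, the event ℰ₀)] -/
def sideCrossL : Set (BondConfig (slab 3 k)) :=
  slabConn k (ringSideL N n) {z | z.2 = -((N : ℤ) + n)} {z | z.2 = (N : ℤ) + n + 1}

/-- The top hub strip crossed between its end columns. [cite: NewmanTassionWu2017, Theorem 3.10 (proof, (3.72))] -/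
def hubCrossT : Set (BondConfig (slab 3 k)) := slabConn k (hubT N n) {z | z.1 = -(N : ℤ) + 1} {z | z.1 = (N : ℤ) - 1}

/-- The right hub strip crossed between its end rows. [cite: NewmanTassionWu2017, Theorem 3.10 (proof, (3.72))] -/
def hubCrossR : Set (BondConfig (slab 3 k)) := slabConn k (hubR N n) {z | z.2 = -(N : ℤ) + 1} {z | z.2 = (N : ℤ) - 1}

/-- The bottom hub strip crossed. [cite: NewmanTassionWu2017, Theorem 3.10 (proof, (3.72))] -/
def hubCrossB : Set (BondConfig (slab 3 k)) := slabConn k (hubB N n) {z | z.1 = -(N : ℤ) + 1} {z | z.1 = (N : ℤ) - 1}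

/-- The left hub strip crossed. [cite: NewmanTassionWu2017, Theorem 3.10 (proof, (3.72))] -/
def hubCrossL : Set (BondConfig (slab 3 k)) := slabConn k (hubL N n) {z | z.2 = -(N : ℤ) + 1} {z | z.2 = (N : ℤ) - 1}

/-- The domain events of the four corner gluings: `dom` crossed end-to-end and the corridor crossed
from its near end line to its far end (so that `Γ` exists and the corridor path crosses the corner
square transversally). [cite: NewmanTassionWu2017, Theorem 3.10 (proof, (3.121)–(3.122))] -/
def cornerDom₁ : Set (BondConfig (slab 3 k)) :=
  slabConn k (domT N n) {z | z.1 = -(N : ℤ)} {z | z.1 = (N : ℤ) + n + 1} ∩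
    slabConn k (corR N n) {z | z.2 = -(N : ℤ)} {z | z.2 = (N : ℤ) + n}

/-- Domain event of the bottom-right gluing (`= ϱ(cornerDom₁)`). [cite: NewmanTassionWu2017, Theorem 3.10 (proof, (3.121)–(3.122))] -/
def cornerDom₂ : Set (BondConfig (slab 3 k)) :=
  slabConn k (domR N n) {z | z.2 = (N : ℤ)} {z | z.2 = -((N : ℤ) + n + 1)} ∩
    slabConn k (corB N n) {z | z.1 = -(N : ℤ)} {z | z.1 = (N : ℤ) + n}

/-- Domain event of the bottom-left gluing. [cite: NewmanTassionWu2017, Theorem 3.10 (proof, (3.121)–(3.122))] -/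
def cornerDom₃ : Set (BondConfig (slab 3 k)) :=
  slabConn k (domB N n) {z | z.1 = (N : ℤ)} {z | z.1 = -((N : ℤ) + n + 1)} ∩
    slabConn k (corL N n) {z | z.2 = (N : ℤ)} {z | z.2 = -((N : ℤ) + n)}

/-- Domain event of the top-left gluing. [cite: NewmanTassionWu2017, Theorem 3.10 (proof, (3.121)–(3.122))] -/
def cornerDom₄ : Set (BondConfig (slab 3 k)) :=
  slabConn k (domL N n) {z | z.2 = -(N : ℤ)} {z | z.2 = (N : ℤ) + n + 1} ∩
    slabConn k (corT N n) {z | z.1 = (N : ℤ)} {z | z.1 = -((N : ℤ) + n)}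

/-- The four corner squares. [cite: NewmanTassionWu2017, Theorem 3.10 (proof, the squares R₁, R₂)] -/
def cornerSq (i : Fin 4) : Set (ℤ × ℤ) :=
  if i = 0 then boxR ((N : ℤ) + 1) ((N : ℤ) + n) ((N : ℤ) + 1) ((N : ℤ) + n)
  else if i = 1 then boxR ((N : ℤ) + 1) ((N : ℤ) + n) (-((N : ℤ) + n)) (-((N : ℤ) + 1))
  else if i = 2 then boxR (-((N : ℤ) + n)) (-((N : ℤ) + 1)) (-((N : ℤ) + n)) (-((N : ℤ) + 1))
  else boxR (-((N : ℤ) + n)) (-((N : ℤ) + 1)) ((N : ℤ) + 1) ((N : ℤ) + n)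

variable (p : unitInterval) (K : ℝ)

/-- **The corner-gluing inequality (top-right corner), the input left to the surgery layer**: for
every bystander event `G` determined by the edges inside the lift of a planar set disjoint from the
corner square, `P[G ∩ cornerDom₁ ∖ cornerLink₁] ≤ K · P[G ∩ cornerLink₁]` (NTW's map `Φ` with
Lemma 3.5: the surgery clears a box inside the corner square, glues the corridor path to
`Γ_min^{domT}`, and is recovered from its image). [cite: NewmanTassionWu2017, Theorem 3.10 (proof, (3.121)–(3.122)) with Lemma 3.5] -/
def CornerGlue₁ : Prop :=
  ∀ (Ω : Set (ℤ × ℤ)) (G : Set (BondConfig (slab 3 k))), Disjoint Ω (cornerSq N n 0) →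
    DeterminedBy G (Set.sym2 (slabLift k Ω)) → MeasurableSet G →
    (bondPercolation (slabGraph 3 k) p).real (G ∩ cornerDom₁ k N n ∩ (cornerLink₁ k N n)ᶜ) ≤
      K * (bondPercolation (slabGraph 3 k) p).real (G ∩ cornerLink₁ k N n)

/-- The corner-gluing inequality at the bottom-right corner. [cite: NewmanTassionWu2017, Theorem 3.10 (proof, (3.121)–(3.122)) with Lemma 3.5] -/
def CornerGlue₂ : Prop :=
  ∀ (Ω : Set (ℤ × ℤ)) (G : Set (BondConfig (slab 3 k))), Disjoint Ω (cornerSq N n 1) →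
    DeterminedBy G (Set.sym2 (slabLift k Ω)) → MeasurableSet G →
    (bondPercolation (slabGraph 3 k) p).real (G ∩ cornerDom₂ k N n ∩ (cornerLink₂ k N n)ᶜ) ≤
      K * (bondPercolation (slabGraph 3 k) p).real (G ∩ cornerLink₂ k N n)

/-- The corner-gluing inequality at the bottom-left corner. [cite: NewmanTassionWu2017, Theorem 3.10 (proof, (3.121)–(3.122)) with Lemma 3.5] -/
def CornerGlue₃ : Prop :=
  ∀ (Ω : Set (ℤ × ℤ)) (G : Set (BondConfig (slab 3 k))), Disjoint Ω (cornerSq N n 2) →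
    DeterminedBy G (Set.sym2 (slabLift k Ω)) → MeasurableSet G →
    (bondPercolation (slabGraph 3 k) p).real (G ∩ cornerDom₃ k N n ∩ (cornerLink₃ k N n)ᶜ) ≤
      K * (bondPercolation (slabGraph 3 k) p).real (G ∩ cornerLink₃ k N n)

/-- The corner-gluing inequality at the top-left corner. [cite: NewmanTassionWu2017, Theorem 3.10 (proof, (3.121)–(3.122)) with Lemma 3.5] -/
def CornerGlue₄ : Prop :=
  ∀ (Ω : Set (ℤ × ℤ)) (G : Set (BondConfig (slab 3 k))), Disjoint Ω (cornerSq N n 3) →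
    DeterminedBy G (Set.sym2 (slabLift k Ω)) → MeasurableSet G →
    (bondPercolation (slabGraph 3 k) p).real (G ∩ cornerDom₄ k N n ∩ (cornerLink₄ k N n)ᶜ) ≤
      K * (bondPercolation (slabGraph 3 k) p).real (G ∩ cornerLink₄ k N n)

end Events

/-! ## What the side crossings supply -/

section Derived

variable {N n : ℕ} {ω : BondConfig (slab 3 k)}

/-- Coordinate functionals are 1-Lipschitz along lattice steps (both directions). [folklore] -/
private theorem lip₂ :
    (∀ z w : ℤ × ℤ, planarAdj z w → (fun z : ℤ × ℤ => z.2) w ≤ (fun z : ℤ × ℤ => z.2) z + 1 ∧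
        (fun z : ℤ × ℤ => z.2) z ≤ (fun z : ℤ × ℤ => z.2) w + 1) ∧
      (∀ z w : ℤ × ℤ, planarAdj z w → (fun z : ℤ × ℤ => -z.2) w ≤ (fun z : ℤ × ℤ => -z.2) z + 1 ∧
        (fun z : ℤ × ℤ => -z.2) z ≤ (fun z : ℤ × ℤ => -z.2) w + 1) ∧
      (∀ z w : ℤ × ℤ, planarAdj z w → (fun z : ℤ × ℤ => z.1) w ≤ (fun z : ℤ × ℤ => z.1) z + 1 ∧
        (fun z : ℤ × ℤ => z.1) z ≤ (fun z : ℤ × ℤ => z.1) w + 1) ∧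
      (∀ z w : ℤ × ℤ, planarAdj z w → (fun z : ℤ × ℤ => -z.1) w ≤ (fun z : ℤ × ℤ => -z.1) z + 1 ∧
        (fun z : ℤ × ℤ => -z.1) z ≤ (fun z : ℤ × ℤ => -z.1) w + 1) := by
  refine ⟨fun z w h => ?_, fun z w h => ?_, fun z w h => ?_, fun z w h => ?_⟩ <;>
    have := abs_sub_le_one_of_planarAdj h <;> simp only <;> omega

/-- Rewriting a crossing event along equal domains and end sets. [folklore] -/
private theorem slabConn_congr_sets {B B' X X' Y : Set (ℤ × ℤ)} (hB : B = B') (hX : X = X')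
    (h : ω ∈ slabConn k B X Y) : ω ∈ slabConn k B' X' Y := by subst hB hX; exact h

/-- `K_T` supplies the top minimal-path domain: `domT` is crossed from `x = -N` to `x = N+n+1`.
[cite: NewmanTassionWu2017, Theorem 3.10 (proof)] -/
theorem domT_cross_of_sideCrossT (hω : ω ⊆ (slabGraph 3 k).edgeSet) (h : ω ∈ sideCrossT k N n) :
    ω ∈ slabConn k (domT N n) {z | z.1 = -(N : ℤ)} {z | z.1 = (N : ℤ) + n + 1} := by
  have h1 := slabConn_suffix hω lip₂.2.2.1 (m := -(N : ℤ)) (fun z hz => by simp only [Set.mem_setOf_eq] at hz; omega)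
    (fun z hz => by simp only [Set.mem_setOf_eq] at hz; omega) h
  refine slabConn_congr_sets ?_ rfl h1
  ext z; simp only [ringSideT, domT, Set.mem_inter_iff, mem_boxR_iff, Set.mem_setOf_eq]; omega

/-- `K_T` supplies the corridor of the top-left corner: `corT` is crossed from `x = N` to `x = -(N+n)`.
[cite: NewmanTassionWu2017, Theorem 3.10 (proof)] -/
theorem corT_cross_of_sideCrossT (hN : 1 ≤ N) (hω : ω ⊆ (slabGraph 3 k).edgeSet) (h : ω ∈ sideCrossT k N n) :
    ω ∈ slabConn k (corT N n) {z | z.1 = (N : ℤ)} {z | z.1 = -((N : ℤ) + n)} := by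
  have h1 := slabConn_suffix hω lip₂.2.2.2 (m := -(N : ℤ)) (fun z hz => by simp only [Set.mem_setOf_eq] at hz; omega)
    (fun z hz => by simp only [Set.mem_setOf_eq] at hz; omega) (slabConn_comm h)
  refine slabConn_congr_sets ?_ ?_ h1
  · ext z; simp only [ringSideT, corT, Set.mem_inter_iff, mem_boxR_iff, Set.mem_setOf_eq]; omega
  · ext z; simp only [Set.mem_setOf_eq]; omega

/-- `K_R` supplies the corridor of the top-right corner: `corR` is crossed from `y = -N` to `y = N+n`.
[cite: NewmanTassionWu2017, Theorem 3.10 (proof)] -/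
theorem corR_cross_of_sideCrossR (hN : 1 ≤ N) (hω : ω ⊆ (slabGraph 3 k).edgeSet) (h : ω ∈ sideCrossR k N n) :
    ω ∈ slabConn k (corR N n) {z | z.2 = -(N : ℤ)} {z | z.2 = (N : ℤ) + n} := by
  have h1 := slabConn_suffix hω lip₂.1 (m := -(N : ℤ)) (fun z hz => by simp only [Set.mem_setOf_eq] at hz; omega)
    (fun z hz => by simp only [Set.mem_setOf_eq] at hz; omega) (slabConn_comm h)
  refine slabConn_congr_sets ?_ rfl h1
  ext z; simp only [ringSideR, corR, Set.mem_inter_iff, mem_boxR_iff, Set.mem_setOf_eq]; omega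

/-- `K_R` supplies the right minimal-path domain: `domR` is crossed from `y = N` to `y = -(N+n+1)`.
[cite: NewmanTassionWu2017, Theorem 3.10 (proof)] -/
theorem domR_cross_of_sideCrossR (hω : ω ⊆ (slabGraph 3 k).edgeSet) (h : ω ∈ sideCrossR k N n) :
    ω ∈ slabConn k (domR N n) {z | z.2 = (N : ℤ)} {z | z.2 = -((N : ℤ) + n + 1)} := by
  have h1 := slabConn_suffix hω lip₂.2.1 (m := -(N : ℤ)) (fun z hz => by simp only [Set.mem_setOf_eq] at hz; omega)
    (fun z hz => by simp only [Set.mem_setOf_eq] at hz; omega) h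
  refine slabConn_congr_sets ?_ ?_ h1
  · ext z; simp only [ringSideR, domR, Set.mem_inter_iff, mem_boxR_iff, Set.mem_setOf_eq]; omega
  · ext z; simp only [Set.mem_setOf_eq]; omega

/-- `K_B` supplies the corridor of the bottom-right corner: `corB` is crossed from `x = -N` to `x = N+n`.
[cite: NewmanTassionWu2017, Theorem 3.10 (proof)] -/
theorem corB_cross_of_sideCrossB (hN : 1 ≤ N) (hω : ω ⊆ (slabGraph 3 k).edgeSet) (h : ω ∈ sideCrossB k N n) :
    ω ∈ slabConn k (corB N n) {z | z.1 = -(N : ℤ)} {z | z.1 = (N : ℤ) + n} := by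
  have h1 := slabConn_suffix hω lip₂.2.2.1 (m := -(N : ℤ)) (fun z hz => by simp only [Set.mem_setOf_eq] at hz; omega)
    (fun z hz => by simp only [Set.mem_setOf_eq] at hz; omega) (slabConn_comm h)
  refine slabConn_congr_sets ?_ rfl h1
  ext z; simp only [ringSideB, corB, Set.mem_inter_iff, mem_boxR_iff, Set.mem_setOf_eq]; omega

/-- `K_B` supplies the bottom minimal-path domain: `domB` is crossed from `x = N` to `x = -(N+n+1)`.
[cite: NewmanTassionWu2017, Theorem 3.10 (proof)] -/
theorem domB_cross_of_sideCrossB (hω : ω ⊆ (slabGraph 3 k).edgeSet) (h : ω ∈ sideCrossB k N n) :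
    ω ∈ slabConn k (domB N n) {z | z.1 = (N : ℤ)} {z | z.1 = -((N : ℤ) + n + 1)} := by
  have h1 := slabConn_suffix hω lip₂.2.2.2 (m := -(N : ℤ)) (fun z hz => by simp only [Set.mem_setOf_eq] at hz; omega)
    (fun z hz => by simp only [Set.mem_setOf_eq] at hz; omega) h
  refine slabConn_congr_sets ?_ ?_ h1
  · ext z; simp only [ringSideB, domB, Set.mem_inter_iff, mem_boxR_iff, Set.mem_setOf_eq]; omega
  · ext z; simp only [Set.mem_setOf_eq]; omega

/-- `K_L` supplies the corridor of the bottom-left corner: `corL` is crossed from `y = N` to `y = -(N+n)`.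
[cite: NewmanTassionWu2017, Theorem 3.10 (proof)] -/
theorem corL_cross_of_sideCrossL (hN : 1 ≤ N) (hω : ω ⊆ (slabGraph 3 k).edgeSet) (h : ω ∈ sideCrossL k N n) :
    ω ∈ slabConn k (corL N n) {z | z.2 = (N : ℤ)} {z | z.2 = -((N : ℤ) + n)} := by
  have h1 := slabConn_suffix hω lip₂.2.1 (m := -(N : ℤ)) (fun z hz => by simp only [Set.mem_setOf_eq] at hz; omega)
    (fun z hz => by simp only [Set.mem_setOf_eq] at hz; omega) (slabConn_comm h)
  refine slabConn_congr_sets ?_ ?_ h1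
  · ext z; simp only [ringSideL, corL, Set.mem_inter_iff, mem_boxR_iff, Set.mem_setOf_eq]; omega
  · ext z; simp only [Set.mem_setOf_eq]; omega

/-- `K_L` supplies the left minimal-path domain: `domL` is crossed from `y = -N` to `y = N+n+1`.
[cite: NewmanTassionWu2017, Theorem 3.10 (proof)] -/
theorem domL_cross_of_sideCrossL (hω : ω ⊆ (slabGraph 3 k).edgeSet) (h : ω ∈ sideCrossL k N n) :
    ω ∈ slabConn k (domL N n) {z | z.2 = -(N : ℤ)} {z | z.2 = (N : ℤ) + n + 1} := by
  have h1 := slabConn_suffix hω lip₂.1 (m := -(N : ℤ)) (fun z hz => by simp only [Set.mem_setOf_eq] at hz; omega)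
    (fun z hz => by simp only [Set.mem_setOf_eq] at hz; omega) h
  refine slabConn_congr_sets ?_ rfl h1
  ext z; simp only [ringSideL, domL, Set.mem_inter_iff, mem_boxR_iff, Set.mem_setOf_eq]; omega

end Derived

end NTW17

end Literature.Probability.Percolation

end
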